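import Summits.FinalStateConjecture.FinalStateConjecture.Theorems.TameCensorship.Negative.GenericityModel
import Mathlib.Analysis.SpecialFunctions.SmoothTransition
import Mathlib.Topology.Baire.Lemmas

/-!
# A property and its negation, BOTH Christodoulou-generic in the typed sense
# (negative-side support for the crux `WeakCosmicCensorshipMGHD`, item `stmt-FinalStateConjecture-9952`:
# the receding-support loophole of `IsChristodoulouGeneric` in miniature)

`InitialDataSet.IsChristodoulouGeneric 𝓓 P 1` (`Genericity.lean`) sees one-parameter families only
through `IsSmoothDataFamily` — joint smoothness on `ℝ¹ × Σ`, a LOCAL condition with no topology at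
spatial infinity. Route `SwallowTheDatum` exploits this against the summit (swallow any datum in an
ever larger exact Kerr black hole). This file isolates the phenomenon in a model where everything is
a theorem: on the Minkowski slice (the model space of `TameCensorship/Negative/GenericityModel.lean`)
take as admissible class the PURE-TRACE data `pureTrace` (`k = s • δ` with `s : ℝ³ → ℝ` smooth)
and the property

  `P D :⟺ k` vanishes outside a bounded set (`boundedK`).

* `isChristodoulouGeneric_hasBoundedK` — `P` is typed-generic on `pureTrace`: through ANY pure-trace
  datum passes the smooth injective admissible family with scalar
  `s_c = χ(c² ‖y‖²) s + c χ(2‖y‖²)` (`χ` a smooth cut-off), equal to the datum at `c = 0` and boundedly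
  supported for every `c ≠ 0` — the support RECEDES to infinity as `c → 0`, and joint smoothness does
  not notice;
* `isChristodoulouGeneric_not_hasBoundedK` — `¬ P` is typed-generic on `pureTrace` as well: through a
  boundedly supported datum passes `k_c = k + c δ`, unboundedly supported for `c ≠ 0`;
* `isChristodoulouGeneric_and_not` — so a property and its negation are both "generic with
  exceptional set of positive codimension" on the same admissible class, on which each holds
  somewhere. For comparison, `not_isTopologicallyGeneric_and_not`: in a nonempty Baire space no
  property is topologically generic together with its negation. The typed curve-genericity is thus
  not a genericity notion in any Baire sense; statements quantified by it (this crux, the summit) can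
  hold for reasons unrelated to the size of the exceptional set.

All results proved; no named facts.

## References

* D. Christodoulou, CQG 16 (1999) A23, p. A24 (the intended notion: lines `α₀ + c f` in a FIXED
  function space — uniform in `c`, which the typed regularisation lost).
-/

noncomputable section

open Bundle TopologicalSpace Manifold Set Function Metric
open scoped ContDiff Topology InnerProductSpace RealInnerProductSpace

namespace Summit.FinalStateConjecture.FinalStateConjecture.Theorems.WeakCosmicCensorshipMGHD.Negative

open Literature.Geometry.Lorentzian
open Summit.FinalStateConjecture.FinalStateConjecture.Theorems.TameCensorship.Negative

/-! ### The class of pure-trace data and the property -/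

/-- Pure-trace data on the slice: `k = s • δ` for a smooth scalar `s` (the metric `h` arbitrary). -/
def pureTrace : Set SliceData :=
  {D | ∃ s : E3 → ℝ, ContDiff ℝ ∞ s ∧ ∀ (x : Minkowski.slice) (v w : E3), D.k x v w = s x * ⟪v, w⟫}

/-- The data whose `k` vanishes outside some ball (the property `P`, as a set). -/
def boundedK : Set SliceData :=
  {D | ∃ R : ℝ, ∀ x : Minkowski.slice, R < ‖(x : E3)‖ → ∀ v w : E3, D.k x v w = 0}

/-- The trivial data are pure trace (`s = 0`). -/
theorem trivialData_mem_pureTrace : trivialData ∈ pureTrace :=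
  ⟨0, contDiff_const, fun x v w ↦ by simp [trivialData]⟩

/-- The trivial data (`k = 0`) have bounded `k`-support. -/
theorem hasBoundedK_trivialData : trivialData ∈ boundedK :=
  ⟨0, fun x _ v w ↦ by simp [trivialData]⟩

/-! ### Smooth cut-off and the receding scalar profile -/

/-- `χ(t) = smoothTransition (2 - t)`: smooth, `= 1` for `t ≤ 1`, `= 0` for `t ≥ 2`. -/
def χ (t : ℝ) : ℝ := Real.smoothTransition (2 - t)

/-- `χ` is smooth. -/
theorem contDiff_χ : ContDiff ℝ ∞ χ :=
  Real.smoothTransition.contDiff.comp (contDiff_const.sub contDiff_id)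

/-- `χ = 1` on `(-∞, 1]`. -/
theorem χ_of_le_one {t : ℝ} (h : t ≤ 1) : χ t = 1 :=
  Real.smoothTransition.one_of_one_le (by linarith)

/-- `χ = 0` on `[2, ∞)`. -/
theorem χ_of_two_le {t : ℝ} (h : 2 ≤ t) : χ t = 0 :=
  Real.smoothTransition.zero_of_nonpos (by linarith)

/-- `χ 0 = 1`. -/
@[simp] theorem χ_zero : χ 0 = 1 := χ_of_le_one zero_le_one

/-- The receding increment of the scalar: `(χ(a² ‖y‖²) - 1) s(y) + a χ(2 ‖y‖²)`, so that
`s + rprof s a = χ(a² ‖y‖²) s + a χ(2‖y‖²)`. -/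
def rprof (s : E3 → ℝ) (a : ℝ) (y : E3) : ℝ := (χ (a ^ 2 * ‖y‖ ^ 2) - 1) * s y + a * χ (2 * ‖y‖ ^ 2)

/-- At the parameter `0` the increment vanishes. -/
theorem rprof_zero (s : E3 → ℝ) (y : E3) : rprof s 0 y = 0 := by simp [rprof]

/-- At the origin the increment is the parameter. -/
theorem rprof_apply_zero (s : E3 → ℝ) (a : ℝ) : rprof s a 0 = a := by simp [rprof]

/-- Far out (`a² ‖y‖² ≥ 2` and `2 ‖y‖² ≥ 2`) the increment is `-s`: the scalar `s + rprof s a`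
vanishes there. -/
theorem rprof_far (s : E3 → ℝ) {a : ℝ} {y : E3} (h1 : 2 ≤ a ^ 2 * ‖y‖ ^ 2) (h2 : 2 ≤ 2 * ‖y‖ ^ 2) :
    s y + rprof s a y = 0 := by
  rw [rprof, χ_of_two_le h1, χ_of_two_le h2]; ring

/-- Joint smoothness of `(c, y) ↦ rprof s (c 0) y` on `ℝ¹ × ℝ³`. -/
theorem contDiff_rprof {s : E3 → ℝ} (hs : ContDiff ℝ ∞ s) :
    ContDiff ℝ ∞ (fun q : EuclideanSpace ℝ (Fin 1) × E3 ↦ rprof s (q.1 0) q.2) := by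
  have h0 : ContDiff ℝ ∞ (fun q : EuclideanSpace ℝ (Fin 1) × E3 ↦ q.1 0) :=
    (contDiff_piLp_apply (p := 2) (i := (0 : Fin 1))).comp contDiff_fst
  have hn : ContDiff ℝ ∞ (fun q : EuclideanSpace ℝ (Fin 1) × E3 ↦ ‖q.2‖ ^ 2) :=
    (contDiff_norm_sq ℝ).comp contDiff_snd
  unfold rprof
  exact (((contDiff_χ.comp ((h0.pow 2).mul hn)).sub contDiff_const).mul (hs.comp contDiff_snd)).add
    (h0.mul (contDiff_χ.comp (contDiff_const.mul hn)))

/-- The scalar at a fixed parameter, `y ↦ rprof s a y`, is smooth. -/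
theorem contDiff_rprof_fixed {s : E3 → ℝ} (hs : ContDiff ℝ ∞ s) (a : ℝ) :
    ContDiff ℝ ∞ (rprof s a) := by
  have h := (contDiff_rprof hs).comp
    ((contDiff_const (c := EuclideanSpace.single (0 : Fin 1) a)).prodMk contDiff_id)
  simpa [Function.comp_def] using h

/-- The ambient `Bil`-valued receding section `rprof • δ` is jointly smooth (pattern of
`contDiff_βamb`: a smooth scalar times the constant vector `δ`). -/
theorem contDiff_rprof_smul {s : E3 → ℝ} (hs : ContDiff ℝ ∞ s) :
    ContDiff ℝ ∞ (fun q : EuclideanSpace ℝ (Fin 1) × E3 ↦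
      rprof s (q.1 0) q.2 • (innerSL ℝ (E := E3) : Bil)) :=
  contDiffOn_univ.1 (contDiffOn_smul_const' (contDiff_rprof hs).contDiffOn (innerSL ℝ (E := E3) : Bil))

/-- The receding section at a fixed parameter is smooth on the slice. -/
theorem contMDiff_rprof_slice {s : E3 → ℝ} (hs : ContDiff ℝ ∞ s) (a : ℝ) :
    ContMDiff 𝓘(ℝ, E3) 𝓘(ℝ, Bil) ∞
      (fun x : Minkowski.slice ↦ rprof s a x • (innerSL ℝ (E := E3) : Bil)) :=
  ((contDiff_rprof_smul hs).comp ((contDiff_const (c := (EuclideanSpace.single (0 : Fin 1) a))).prodMk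
    contDiff_id)).contMDiff.comp contMDiff_subtype_val |>.congr (fun x ↦ by simp)

/-! ### The receding family through a pure-trace datum -/

/-- The receding family through `D` (with scalar `s`): `k_c = k + rprof s c₀ • δ`. -/
def recedeFam (D : SliceData) (s : E3 → ℝ) (hs : ContDiff ℝ ∞ s) (c : EuclideanSpace ℝ (Fin 1)) :
    SliceData :=
  addK D (fun x ↦ rprof s (c 0) x • (innerSL ℝ (E := E3) : Bil))
    (fun x v w ↦ by
      change rprof s (c 0) x * ⟪v, w⟫ = rprof s (c 0) x * ⟪w, v⟫
      rw [real_inner_comm])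
    (contMDiff_rprof_slice hs (c 0))

/-- Evaluation of `k` along the receding family. -/
theorem recedeFam_k_apply (D : SliceData) (s : E3 → ℝ) (hs : ContDiff ℝ ∞ s)
    (c : EuclideanSpace ℝ (Fin 1)) (x : Minkowski.slice) (v w : E3) :
    (recedeFam D s hs c).k x v w = D.k x v w + rprof s (c 0) x * ⟪v, w⟫ := rfl

section Recede

variable {D : SliceData} {s : E3 → ℝ} (hs : ContDiff ℝ ∞ s)

/-- Along the receding family the datum stays pure trace, with scalar `s + rprof s c₀`. -/
theorem recedeFam_mem_pureTrace (hk : ∀ (x : Minkowski.slice) (v w : E3), D.k x v w = s x * ⟪v, w⟫)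
    (c : EuclideanSpace ℝ (Fin 1)) : recedeFam D s hs c ∈ pureTrace :=
  ⟨fun y ↦ s y + rprof s (c 0) y, hs.add (contDiff_rprof_fixed hs (c 0)), fun x v w ↦ by
    rw [recedeFam_k_apply, hk]; ring⟩

/-- At `c = 0` the receding family is the datum. -/
theorem recedeFam_zero : recedeFam D s hs 0 = D := by
  refine sliceData_ext rfl (funext fun x ↦ ?_)
  ext v w
  rw [recedeFam_k_apply]
  simp [rprof_zero]

/-- The observable `k(0)(e,e)` recovers the parameter. -/
theorem recedeFam_k_p₀ (c : EuclideanSpace ℝ (Fin 1)) :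
    (recedeFam D s hs c).k p₀ e e = D.k p₀ e e + c 0 := by
  rw [recedeFam_k_apply, coe_p₀, rprof_apply_zero, inner_e_e, mul_one]

/-- The receding family is injective. -/
theorem recedeFam_injective : Injective (recedeFam D s hs) := by
  intro c c' h
  have := congrArg (fun D' : SliceData ↦ D'.k p₀ e e) h
  simp only [recedeFam_k_p₀, add_right_inj] at this
  exact euclid1_ext this

/-- For `c ≠ 0` the member `k_c` vanishes outside the ball of radius `max (√2 / |c₀|) 1`: the
support has RECEDED to radius `∼ |c₀|⁻¹`. -/
theorem hasBoundedK_recedeFam (hk : ∀ (x : Minkowski.slice) (v w : E3), D.k x v w = s x * ⟪v, w⟫)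
    {c : EuclideanSpace ℝ (Fin 1)} (hc : c ≠ 0) : recedeFam D s hs c ∈ boundedK := by
  have hc0 : c 0 ≠ 0 := euclid1_ne_zero hc
  refine ⟨max (Real.sqrt 2 / |c 0|) 1, fun x hx v w ↦ ?_⟩
  have hx1 : 1 < ‖(x : E3)‖ := lt_of_le_of_lt (le_max_right _ _) hx
  have hx2 : Real.sqrt 2 / |c 0| < ‖(x : E3)‖ := lt_of_le_of_lt (le_max_left _ _) hx
  have habs : 0 < |c 0| := abs_pos.2 hc0
  have h2 : 2 ≤ (c 0) ^ 2 * ‖(x : E3)‖ ^ 2 := by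
    rw [div_lt_iff₀ habs] at hx2
    have hsq : (Real.sqrt 2) ^ 2 = 2 := Real.sq_sqrt (by norm_num)
    have hpos : 0 ≤ Real.sqrt 2 := Real.sqrt_nonneg 2
    have hsq' : (Real.sqrt 2) ^ 2 ≤ (‖(x : E3)‖ * |c 0|) ^ 2 := by gcongr
    rw [hsq, mul_pow, sq_abs] at hsq'
    linarith
  have h3 : 2 ≤ 2 * ‖(x : E3)‖ ^ 2 := by nlinarith
  rw [recedeFam_k_apply, hk, ← add_mul, rprof_far s h2 h3, zero_mul]

/-- Joint smoothness of the receding family (pattern of `isSmoothDataFamily_fam`). -/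
theorem isSmoothDataFamily_recedeFam : InitialDataSet.IsSmoothDataFamily 1 (recedeFam D s hs) := by
  refine ⟨D.h.contMDiff.comp contMDiff_snd, fun q ↦ ?_⟩
  refine (contMDiffAt_totalSpace_bilin_iff Minkowski.slice Prod.snd
    (fun q : EuclideanSpace ℝ (Fin 1) × Minkowski.slice ↦
      kBil D q.2 + rprof s (q.1 0) (q.2 : E3) • (innerSL ℝ (E := E3) : Bil)) q).2
    ⟨contMDiffAt_snd, ?_⟩
  have h2 : ContMDiff (𝓘(ℝ, EuclideanSpace ℝ (Fin 1)).prod 𝓘(ℝ, E3))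
      𝓘(ℝ, EuclideanSpace ℝ (Fin 1) × E3) ∞
      (fun q : EuclideanSpace ℝ (Fin 1) × Minkowski.slice ↦ (q.1, (q.2 : E3))) :=
    contMDiff_fst.prodMk_space (contMDiff_subtype_val.comp contMDiff_snd)
  exact (((contMDiff_kBil D).comp contMDiff_snd) q).add (((contDiff_rprof_smul hs).comp_contMDiff h2) q)

end Recede

/-- **`boundedK` is typed-generic on the pure-trace class**: through every pure-trace datum
(exceptional or not) passes the receding family, admissible, injective, jointly smooth, all of whose
nonzero-parameter members have boundedly supported `k`. The "exceptional set" — all pure-trace data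
with an unbounded scalar tail, i.e. almost the whole class — is thereby certified of positive
codimension. -/
theorem isChristodoulouGeneric_hasBoundedK :
    InitialDataSet.IsChristodoulouGeneric pureTrace (· ∈ boundedK) 1 := by
  rintro D ⟨⟨s, hs, hk⟩, -⟩
  exact ⟨recedeFam D s hs, isSmoothDataFamily_recedeFam hs, recedeFam_zero hs,
    recedeFam_injective hs, fun c ↦ recedeFam_mem_pureTrace hs hk c,
    fun c hc hmem ↦ hmem.2 (hasBoundedK_recedeFam hs hk hc)⟩

/-! ### The constant family `k_c = k + c δ` -/

/-- Along the constant family `fam D id id` a pure-trace datum stays pure trace (scalar `s + c₀`). -/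
theorem fam_mem_pureTrace {D : SliceData} {s : E3 → ℝ} (hs : ContDiff ℝ ∞ s)
    (hk : ∀ (x : Minkowski.slice) (v w : E3), D.k x v w = s x * ⟪v, w⟫)
    (c : EuclideanSpace ℝ (Fin 1)) : fam D id id c ∈ pureTrace :=
  ⟨fun y ↦ s y + c 0, hs.add contDiff_const, fun x v w ↦ by
    rw [fam_k_apply, hk, βamb_apply]; simp only [id_eq]; ring⟩

/-- Far away along the constant family through a boundedly supported datum the tensor is `c₀ δ ≠ 0`. -/
theorem not_hasBoundedK_fam {D : SliceData} (hD : D ∈ boundedK) {c : EuclideanSpace ℝ (Fin 1)}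
    (hc : c ≠ 0) : ¬ fam D id id c ∈ boundedK := by
  rintro ⟨R, hR⟩
  obtain ⟨R₀, hR₀⟩ := hD
  set t : ℝ := |R| + |R₀| + 1 with ht
  have hpt : ‖(t • e : E3)‖ = t := by
    rw [norm_smul, norm_e, mul_one, Real.norm_eq_abs, abs_of_nonneg (by positivity)]
  set x : Minkowski.slice := ⟨t • e, Minkowski.mem_slice _⟩
  have hxR : R < ‖(x : E3)‖ := by
    change R < ‖(t • e : E3)‖; rw [hpt, ht]; linarith [le_abs_self R, abs_nonneg R₀]
  have hxR₀ : R₀ < ‖(x : E3)‖ := by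
    change R₀ < ‖(t • e : E3)‖; rw [hpt, ht]; linarith [le_abs_self R₀, abs_nonneg R]
  have h1 := hR x hxR e e
  rw [fam_k_apply, hR₀ x hxR₀ e e, βamb_apply, inner_e_e] at h1
  simp only [id_eq, mul_one, zero_add] at h1
  exact euclid1_ne_zero hc (by linarith)

/-- **The complement of `boundedK` is typed-generic on the pure-trace class too**: through every boundedly
supported pure-trace datum passes the constant family `k + c δ`, unboundedly supported for `c ≠ 0`. -/
theorem isChristodoulouGeneric_not_hasBoundedK :
    InitialDataSet.IsChristodoulouGeneric pureTrace (fun D ↦ D ∉ boundedK) 1 := by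
  rintro D ⟨⟨s, hs, hk⟩, hD⟩
  have hD' : D ∈ boundedK := not_not.1 hD
  refine ⟨fam D id id, isSmoothDataFamily_fam D contDiff_id contDiff_id, fam_zero D id id rfl rfl,
    ?_, fun c ↦ fam_mem_pureTrace hs hk c, fun c hc hmem ↦ hmem.2 (not_hasBoundedK_fam hD' hc)⟩
  intro c c' h
  have := congrArg (fun D' : SliceData ↦ D'.k p₀ e e) h
  simp only [fam_k_p₀, id_eq, add_right_inj] at this
  exact euclid1_ext this

/-- Some pure-trace datum is NOT boundedly supported (so neither property is vacuous on the class). -/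
theorem exists_mem_pureTrace_not_hasBoundedK : ∃ D ∈ pureTrace, ¬ D ∈ boundedK := by
  obtain ⟨s, hs, hk⟩ := trivialData_mem_pureTrace
  refine ⟨fam trivialData id id (EuclideanSpace.single 0 1), fam_mem_pureTrace hs hk _,
    not_hasBoundedK_fam hasBoundedK_trivialData fun h ↦ ?_⟩
  simpa using congrArg (fun c : EuclideanSpace ℝ (Fin 1) ↦ c 0) h

/-- **A property and its negation, both Christodoulou-generic in the typed sense, on one admissible
class on which each holds somewhere.** The typed `IsChristodoulouGeneric … 1` certifies "positive
codimension" for a set AND for its complement, so it is not a genericity notion. The mechanism on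
the `boundedK` side — supports receding to infinity along a jointly smooth family — is the one
route `SwallowTheDatum` uses against the summit statement (burial in ever larger Kerr black holes). -/
theorem isChristodoulouGeneric_and_not :
    ∃ (𝓓 : Set SliceData) (P : SliceData → Prop), (∃ D ∈ 𝓓, P D) ∧ (∃ D ∈ 𝓓, ¬ P D) ∧
      InitialDataSet.IsChristodoulouGeneric 𝓓 P 1 ∧
      InitialDataSet.IsChristodoulouGeneric 𝓓 (fun D ↦ ¬ P D) 1 :=
  ⟨pureTrace, (· ∈ boundedK), ⟨trivialData, trivialData_mem_pureTrace, hasBoundedK_trivialData⟩,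
    exists_mem_pureTrace_not_hasBoundedK, isChristodoulouGeneric_hasBoundedK,
    isChristodoulouGeneric_not_hasBoundedK⟩

/-- **Contrast: Baire genericity never holds for a property and its negation** on a nonempty Baire
space (two residual sets meet). -/
theorem not_isTopologicallyGeneric_and_not {𝔻 : Type*} [TopologicalSpace 𝔻] [BaireSpace 𝔻]
    [Nonempty 𝔻] (P : 𝔻 → Prop) :
    ¬ (IsTopologicallyGeneric P ∧ IsTopologicallyGeneric fun d ↦ ¬ P d) := by
  rintro ⟨hP, hnP⟩
  have h : {d | P d} ∩ {d | ¬ P d} ∈ residual 𝔻 := Filter.inter_mem hP hnP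
  obtain ⟨d, hd⟩ := (dense_of_mem_residual h).nonempty
  exact hd.2 hd.1

end Summit.FinalStateConjecture.FinalStateConjecture.Theorems.WeakCosmicCensorshipMGHD.Negative

end
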